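import Summits.AnomalousDissipation.AnomalousDissipation.Theorems.BaireTransferRobustLoudUpgradeLineCrossingGlue2
import Summits.AnomalousDissipation.AnomalousDissipation.Theorems.BaireTransferRobustLoudUpgradeStubPeriodicCrossingPersist
import Summits.AnomalousDissipation.AnomalousDissipation.Theorems.BaireTransferRobustLoudUpgradeStubPeriodicRobustCrossingClosure

/-!
# Line `malkin-cone-group-orbits`, companion c3 ("Lyapunov–Schmidt crossing for TIME-PERIODIC witnesses"):
# the two periodic crossing classes, the tame union `tamePeriodic`, and the line glue

Definitions + glue (reviewed for the three definitions).  Henry's perturbation theorem being discharged in the tree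
(`Literature.Analysis.FluidPDE.PeriodicNSOrbitPersists_holds`), the companion c3 organises the DEGENERATE periodic loud witnesses
exactly as the companion c2 organised the degenerate steady ones: `crossingPeriodic` (interface of engine (E1): a real family
`σ` on `P_S × ℝ` whose zeros near `(c, 0)` are periodic classical solutions of the uncorrected forces, uniformly `H¹`-close to `u`
after the linear time rescaling, and which changes sign in `s` at `c`) and `robustCrossingPeriodic` (engine (E2): sign changes at
forces `c₁ → c`).  Both are TAME by the landed Pi-form stubs `PeriodicCrossingPersist.stub_periodicCrossingPersist` (IVT ⇒
`PeriodicPersistsAt` ⇒ `persistPeriodic ⊆ interior LOUD`, periodic window p82010) and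
`PeriodicRobustCrossingClosure.stub_periodicRobustCrossingClosure` (`closure (interior LOUD)`).  `tamePeriodic := tameCrossing2 ∪
crossingPeriodic ∪ robustCrossingPeriodic`; `line_glue_c3` (registered): the residual over `tamePeriodic` proves the crux BY NAME.
The family itself (`stub_lsFamilyPeriodic`, the space–time-lattice Lyapunov–Schmidt family of a simply degenerate orbit) and its
concrete members (folds of cycles, subharmonic pitchforks of cycles) land separately.  References: Chow–Hale 1982 Ch. 6, 9;
Kielhöfer 2012 §I.12–I.13; Iooss 1972; Henry 1981 Ch. 8.
-/

-- `Summit.<Summit>.<Problem>` is the tree's mandated summit-side namespace (CONVENTIONS §2); for this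
-- single-conjunct summit the two coincide, so the duplicate is deliberate.
set_option linter.dupNamespace false

noncomputable section

open scoped BigOperators Topology
open Filter Set Function TopologicalSpace MeasureTheory

namespace Summit.AnomalousDissipation.AnomalousDissipation.Theorems.RobustLoudUpgrade

open Literature.Analysis.FunctionSpaces Literature.Analysis.FunctionSpaces.Torus
open Literature.Analysis.FluidPDE
open Summit.AnomalousDissipation.AnomalousDissipation.Theses.BaireTransfer

/-! ## §1 The two periodic crossing classes and the tame union of the companion c3 -/

/-- **Crossing periodic witnesses** (interface of engine (E1), periodic twin of `crossingSteady`).  `c` carries, at some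
`ν ∈ (0,a)`, a `τ`-periodic classical solution `u` with STRICT budgets and a real function `σ` on `P_S × ℝ` such that (i) for every
`δ > 0`, on some ball around `(c, 0)`, `σ` is continuous and each of its ZEROS `q = (c', s)` yields a time-periodic classical solution
of the UNCORRECTED force `f_{c'}` whose orbit is, uniformly in time and after the linear time rescaling matching the periods, within `δ`
of `u` in `L² ∩ Ḣ¹` (what the periodic Lyapunov–Schmidt family delivers), and (ii) `s ↦ σ(c, s)` takes BOTH signs in every
neighbourhood of `0`. (Chow–Hale 1982 Ch. 6, Ch. 9.) [folklore] -/
def crossingPeriodic (S : Finset (Fin 3 → ℤ)) (a E ε : ℝ) : Set (Coeff S) :=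
  {c | ∃ ν : ℝ, 0 < ν ∧ ν < a ∧ ∃ (τ : ℝ) (u : ℝ → UnitAddTorus (Fin 3) → EuclideanSpace ℝ (Fin 3))
      (p : ℝ → UnitAddTorus (Fin 3) → ℝ), 0 < τ ∧
    IsClassicalNSSolutionOn Set.univ ν (fun _ => force S c) u p ∧ Function.Periodic u τ ∧
      meanEnergy u < E ∧ ε < meanDissipation ν u ∧
      ∃ σ : Coeff S × ℝ → ℝ,
        (∀ δ : ℝ, 0 < δ → ∃ r : ℝ, 0 < r ∧ ContinuousOn σ (Metric.ball (c, (0 : ℝ)) r) ∧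
          ∀ q ∈ Metric.ball (c, (0 : ℝ)) r, σ q = 0 →
            ∃ (τ' : ℝ) (u' : ℝ → UnitAddTorus (Fin 3) → EuclideanSpace ℝ (Fin 3)) (p' : ℝ → UnitAddTorus (Fin 3) → ℝ),
              0 < τ' ∧ IsClassicalNSSolutionOn Set.univ ν (fun _ => force S q.1) u' p' ∧ Function.Periodic u' τ' ∧
              ∀ t, (∫ x, ‖u' t x - u (τ / τ' * t) x‖ ^ 2) + gradNormSq (fun x => u' t x - u (τ / τ' * t) x) ≤ δ) ∧
        ∀ η : ℝ, 0 < η → ∃ s₁ s₂ : ℝ, |s₁| < η ∧ |s₂| < η ∧ σ (c, s₁) < 0 ∧ 0 < σ (c, s₂)}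

/-- **Robustly crossing periodic witnesses** (interface of engine (E2), periodic twin of `robustCrossingSteady`): as
`crossingPeriodic`, except that the sign change of `σ(c₁, ·)` near `0` is only asked at forces `c₁` ARBITRARILY CLOSE to `c`
(folds = saddle-nodes of cycles are limits of the two-orbit side). (Kielhöfer 2012 §I.12–I.13.) [folklore] -/
def robustCrossingPeriodic (S : Finset (Fin 3 → ℤ)) (a E ε : ℝ) : Set (Coeff S) :=
  {c | ∃ ν : ℝ, 0 < ν ∧ ν < a ∧ ∃ (τ : ℝ) (u : ℝ → UnitAddTorus (Fin 3) → EuclideanSpace ℝ (Fin 3))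
      (p : ℝ → UnitAddTorus (Fin 3) → ℝ), 0 < τ ∧
    IsClassicalNSSolutionOn Set.univ ν (fun _ => force S c) u p ∧ Function.Periodic u τ ∧
      meanEnergy u < E ∧ ε < meanDissipation ν u ∧
      ∃ σ : Coeff S × ℝ → ℝ,
        (∀ δ : ℝ, 0 < δ → ∃ r : ℝ, 0 < r ∧ ContinuousOn σ (Metric.ball (c, (0 : ℝ)) r) ∧
          ∀ q ∈ Metric.ball (c, (0 : ℝ)) r, σ q = 0 →
            ∃ (τ' : ℝ) (u' : ℝ → UnitAddTorus (Fin 3) → EuclideanSpace ℝ (Fin 3)) (p' : ℝ → UnitAddTorus (Fin 3) → ℝ),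
              0 < τ' ∧ IsClassicalNSSolutionOn Set.univ ν (fun _ => force S q.1) u' p' ∧ Function.Periodic u' τ' ∧
              ∀ t, (∫ x, ‖u' t x - u (τ / τ' * t) x‖ ^ 2) + gradNormSq (fun x => u' t x - u (τ / τ' * t) x) ≤ δ) ∧
        ∀ η : ℝ, 0 < η → ∃ (c₁ : Coeff S) (s₁ s₂ : ℝ), dist c₁ c < η ∧ |s₁| < η ∧ |s₂| < η ∧
          σ (c₁, s₁) < 0 ∧ 0 < σ (c₁, s₂)}

/-- The tame union of the companion c3: c2's `tameCrossing2` plus the two periodic crossing classes. [folklore] -/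
def tamePeriodic (S : Finset (Fin 3 → ℤ)) (a E ε : ℝ) : Set (Coeff S) :=
  tameCrossing2 S a E ε ∪ crossingPeriodic S a E ε ∪ robustCrossingPeriodic S a E ε

namespace LsCrossingPeriodic

/-! ## §2 Glue (sorry-free): the periodic crossing classes are tame; the residual proves the crux BY NAME -/

/-- **A crossing at `c` is in particular a robust crossing** (take `c₁ = c`; registered sub-goal
`crossingPeriodic_subset_robust`). [folklore] -/
theorem crossingPeriodic_subset_robust : ∀ (S : Finset (Fin 3 → ℤ)) (a E ε : ℝ), crossingPeriodic S a E ε ⊆ robustCrossingPeriodic S a E ε := by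
  intro S a E ε c hc
  obtain ⟨ν, hν, hνa, τ, u, p, hτ, hsol, hper, hE, hε, σ, hfam, hsign⟩ := hc
  refine ⟨ν, hν, hνa, τ, u, p, hτ, hsol, hper, hE, hε, σ, hfam, fun η hη => ?_⟩
  obtain ⟨s₁, s₂, h₁, h₂, hs₁, hs₂⟩ := hsign η hη
  exact ⟨c, s₁, s₂, by rw [dist_self]; exact hη, h₁, h₂, hs₁, hs₂⟩

/-- **(E1, periodic)** `crossingPeriodic ⊆ persistPeriodic` (landed `PeriodicCrossingPersist.stub_periodicCrossingPersist`). [folklore] -/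
theorem crossingPeriodic_subset_persistPeriodic (S : Finset (Fin 3 → ℤ)) (a E ε : ℝ) :
    crossingPeriodic S a E ε ⊆ persistPeriodic S a E ε := by
  intro c hc
  obtain ⟨ν, hν, hνa, τ, u, p, hτ, hsol, hper, hE, hε, σ, hfam, hsign⟩ := hc
  exact ⟨ν, hν, hνa, τ, u, p, hτ, hsol, hper, hE, hε,
    PeriodicCrossingPersist.stub_periodicCrossingPersist S c ν τ u σ hfam hsign⟩

/-- **(E1, periodic), concluded**: `crossingPeriodic ⊆ interior LOUD` at the same strict budgets (landed periodic window
`PeriodicWindow.stub_periodicWindow`). [folklore] -/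
theorem crossingPeriodic_subset_interior_loud (S : Finset (Fin 3 → ℤ)) (a E ε : ℝ) :
    crossingPeriodic S a E ε ⊆ interior (loud S a E ε) :=
  (crossingPeriodic_subset_persistPeriodic S a E ε).trans (PeriodicWindow.stub_periodicWindow S a E ε)

/-- **(E2, periodic)** `robustCrossingPeriodic ⊆ closure (interior LOUD)` at the same strict budgets (landed
`PeriodicRobustCrossingClosure.stub_periodicRobustCrossingClosure`). [folklore] -/
theorem robustCrossingPeriodic_subset_closure_interior_loud (S : Finset (Fin 3 → ℤ)) (a E ε : ℝ) :
    robustCrossingPeriodic S a E ε ⊆ closure (interior (loud S a E ε)) := by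
  intro c hc
  obtain ⟨ν, hν, hνa, τ, u, p, hτ, hsol, hper, hE, hε, σ, hfam, hsign⟩ := hc
  exact PeriodicRobustCrossingClosure.stub_periodicRobustCrossingClosure S a E ε c ν τ u p σ hν hνa hτ hsol hper hE hε hfam hsign

/-- **The tame union of the companion c3 is force-open up to closure.** [folklore] -/
theorem tamePeriodic_subset_closure_interior_loud (S : Finset (Fin 3 → ℤ)) (a E ε : ℝ) :
    tamePeriodic S a E ε ⊆ closure (interior (loud S a E ε)) :=
  Set.union_subset (Set.union_subset (LsCrossing.tameCrossing2_subset_closure_interior_loud S a E ε)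
    ((crossingPeriodic_subset_interior_loud S a E ε).trans subset_closure))
    (robustCrossingPeriodic_subset_closure_interior_loud S a E ε)

/-- **Line glue of the companion c3 (registered sub-goal `line_glue_c3`)**: the residual over `tamePeriodic` proves the crux
`RobustLoudUpgrade` BY NAME (`LsCrossing.RobustLoudUpgrade_of_residual`). [folklore] -/
theorem line_glue_c3 : (∀ S : Finset (Fin 3 → ℤ), unitStock ⊆ S → ∀ (a E ε : ℝ), 0 < a → 0 < ε → loud S a E ε ⊆ closure (tamePeriodic S a (2 * E) (ε / 2))) → RobustLoudUpgrade :=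
  fun hRes => LsCrossing.RobustLoudUpgrade_of_residual (fun S a E ε => tamePeriodic S a E ε)
    tamePeriodic_subset_closure_interior_loud hRes

end LsCrossingPeriodic

end Summit.AnomalousDissipation.AnomalousDissipation.Theorems.RobustLoudUpgrade

end
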